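import Summits.QuantumFields.YangMills.Theorems.AlphaInputsT3ACv3EMLTwoFieldIterUniform
import Summits.QuantumFields.YangMills.Theorems.AlphaInputsT3ACv3LinearLiftMatrixCLM
import Summits.QuantumFields.YangMills.Theorems.AlphaInputsT3ACv3NewtonDefectMap
import Literature.Analysis.Complex.RungeUnits
import HarnessLib

/-!
# `AlphaInputsT3ACv3NewtonLiftFlatLinearisation` — STRATEGY B for 2′, the (FL) row under OWNER RULING g24-№4: **HYPOTHESIS (i) OF THE NEWTON SHELL FOR THE DEFECT MAP, IN THE FLAT FRAME**
# — for `Φ(a)(c) = log(avg^k(e^{a}U₀)(c)·V(c)*)` and `T = Q^{(k)}` (w3's `avgCLM` ∕ `linAvgIterM`): `‖Φ(a′)(c) − Φ(a)(c) − (Q^{(k)}(a′ − a))(c)‖ ≤ Κ·sup‖a′ − a‖` with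
# `Κ = (d+1)L^k·O(L^k r + L^k η + η₀)` — lane `pub-balaban3d` ∕ cell `ym3-torus`, seat `ym-ust-19936-w4` (g0)

WHY (this seat's CLAIM R6-FLAT, cell `ym3-torus` STATUS 2026-08-28; memo `NEWTON-FL-FRAMES-w4-g0.md` §1).  The model Newton lift (flat global frame: `‖U₀,b − 1‖ ≤ η` on the whole torus)
needs the Lipschitz bound of `Φ − T` on a sup-ball of radius `r`.  It is ★w1's k-UNIFORM two-field derivative row R3 (`EMLTwoField.norm_iter_sub_iter_sub_iterLin_le_uniform`, fields
`U₁ = e^{a′}U₀`, `U₂ = e^{a}U₀`) dressed by three letters: the two-field exponential (`e^{a′}U₀ − e^{a}U₀ = (a′ − a) + O((r + η)‖a′−a‖)`, §1), the two-field logarithm of the defects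
(`NewtonDefectMap.norm_mlog_defect_sub_sub_le`, from `FederbushMean.norm_mlog_sub_mlog_sub_le`), and `‖V(c) − 1‖ ≤ 2m_k(η) + η₀` (the datum is near the average of the near-flat start).
* §1 `norm_exp_sub_exp_sub_sub_le` (`‖e^x − e^y − (x − y)‖ ≤ ‖x − y‖·(e^{max‖x‖,‖y‖} − 1)`, any complete normed algebra), field-size letters `norm_expField_sub_one_le`, `norm_expField_sub_expField_le`,
  `norm_expField_rest_le`.
* §2 ★★ `norm_mlogDefect_sub_sub_linAvgIterM_le` — THE (i)-ROW with an explicit k-free bracket: `Κ = (d+1)L^k·[16|n|²ρ_D + 20800|n|²L(d+2)²(m_k(4r) + m_k(2r+η)) + (2r + η) + v]`,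
  `ρ_D = 2m_k(2r) + η₀`, `v = 2m_k(η) + η₀`, `m_k(x) = 2|n|²(d+1)L^k x`.
Count-neutral helper toward R3 2′ (items 19936∕19935); `hLift`∕(FL) NOT proved here; registry untouched; nothing about d = 4, the continuum, or a mass gap; YM₃ on T³ is rung R3, not Clay.

References: T. Bałaban, Commun. Math. Phys. 98 (1985) 17–51 [Balaban1985Averaging] (Prop. 4 (134)–(135) p.38, Prop. 5 (156)–(157) p.42, (20)–(23) p.21); CMP 102 (1985) 277–309
[Balaban1985Variational] ((8), (11)–(15) pp.279–280).
-/

set_option autoImplicit false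

noncomputable section

open scoped Matrix.Norms.L2Operator Nat
open NormedSpace

namespace Summit.QuantumFields.YangMills.Theorems.NewtonLiftFlat

open Literature.MathematicalPhysics.QuantumFieldTheory.Balaban1983to89
open Literature.MathematicalPhysics.QuantumFieldTheory.Balaban1983to89.MatrixLog (mlog)
open T4Continuum BlockAveraging ExpMeanLog BlockAveragingEMLLinearised
open Summit.QuantumFields.YangMills.Theorems.LinearLiftMatrix (linAvgIterM linAvgIterM_zero linAvgIterM_succ avgCLM avgCLM_apply norm_linAvgIterM_le)
open Summit.QuantumFields.YangMills.Theorems.EMLTwoField (norm_iter_sub_iter_sub_iterLin_le_uniform)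
open Summit.QuantumFields.YangMills.Theorems.NewtonDefectMap (norm_mlog_defect_sub_sub_le norm_defect_sub_defect_eq)
open Summit.QuantumFields.YangMills.Theorems.Prop7HolRatioPerStep (coe_star_mul_self coe_mul_star_self)

/-! ## §1 Letters: the two-field exponential; sizes of `e^{a}·U₀` -/

section Algebra

variable {𝔄 : Type*} [NormedRing 𝔄] [NormedAlgebra ℂ 𝔄] [CompleteSpace 𝔄] [NormOneClass 𝔄]

/-- **THE TWO-FIELD EXPONENTIAL**: `‖e^x − e^y − (x − y)‖ ≤ ‖x − y‖·(e^{M} − 1)`, `M = max(‖x‖, ‖y‖)` — termwise from `‖x^{m+1} − y^{m+1}‖ ≤ (m+1)M^m‖x − y‖`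
(`Literature.Analysis.Complex.norm_pow_succ_sub_pow_succ_le`), the `m = 0` term being exactly `x − y`. [folklore] -/
theorem norm_exp_sub_exp_sub_sub_le (x y : 𝔄) : ‖exp x - exp y - (x - y)‖ ≤ ‖x - y‖ * (Real.exp (max ‖x‖ ‖y‖) - 1) := by
  set M := max ‖x‖ ‖y‖ with hM
  have hM0 : 0 ≤ M := le_max_of_le_left (norm_nonneg _)
  -- the series of `e^x − e^y` past its first two terms
  have hsub := (exp_series_hasSum_exp' (𝕂 := ℂ) x).sub (exp_series_hasSum_exp' (𝕂 := ℂ) y)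
  have h2 : HasSum (fun m : ℕ => ((((m + 2)! : ℕ) : ℂ)⁻¹ • x ^ (m + 2) - (((m + 2)! : ℕ) : ℂ)⁻¹ • y ^ (m + 2)))
      (exp x - exp y - (x - y)) := by
    have := (hasSum_nat_add_iff' 2).mpr hsub
    simpa [Finset.sum_range_succ] using this
  -- the dominating real series `M^{m+1}/(m+1)! · ‖x − y‖`, summing to `(e^M − 1)‖x − y‖`
  have hreal : HasSum (fun m : ℕ => M ^ m / m !) (Real.exp M) := by
    have h := exp_series_hasSum_exp' (𝕂 := ℝ) M
    rw [← Real.exp_eq_exp_ℝ] at h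
    simpa [smul_eq_mul, div_eq_inv_mul] using h
  have hreal1 : HasSum (fun m : ℕ => M ^ (m + 1) / (m + 1)! * ‖x - y‖) ((Real.exp M - 1) * ‖x - y‖) := by
    have h := (hasSum_nat_add_iff' 1).mpr hreal
    simp only [Finset.range_one, Finset.sum_singleton, pow_zero, Nat.factorial_zero, Nat.cast_one, div_one] at h
    exact h.mul_right ‖x - y‖
  rw [mul_comm]
  refine le_of_tendsto_of_tendsto' h2.tendsto_sum_nat.norm hreal1.tendsto_sum_nat fun s => ?_
  refine (norm_sum_le _ _).trans (Finset.sum_le_sum fun m _ => ?_)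
  rw [← smul_sub, norm_smul, norm_inv, Complex.norm_natCast]
  have hfac : (((m + 2)! : ℕ) : ℝ) = ((m : ℝ) + 2) * (((m + 1)! : ℕ) : ℝ) := by
    rw [Nat.factorial_succ (m + 1)]; push_cast; ring
  have hm0 : (0 : ℝ) < (((m + 1)! : ℕ) : ℝ) := by positivity
  have hpow := Literature.Analysis.Complex.norm_pow_succ_sub_pow_succ_le x y (m + 1)
  rw [← hM] at hpow
  calc ((((m + 2)! : ℕ) : ℝ))⁻¹ * ‖x ^ (m + 2) - y ^ (m + 2)‖
      ≤ ((((m + 2)! : ℕ) : ℝ))⁻¹ * (((m + 1 : ℕ) : ℝ) + 1) * M ^ (m + 1) * ‖x - y‖ := by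
        rw [mul_assoc, mul_assoc]
        refine mul_le_mul_of_nonneg_left ?_ (by positivity)
        have := hpow
        push_cast at this ⊢
        nlinarith [this]
    _ = M ^ (m + 1) / (m + 1)! * ‖x - y‖ := by
        rw [hfac]
        field_simp
        push_cast
        ring

end Algebra

section Fields

variable {n : Type*} [Fintype n] [DecidableEq n] [Nonempty n] {P : Params}

omit [Nonempty n] in
/-- **SIZE OF THE PERTURBED FIELD**: `‖e^{a_b}U₀,b − 1‖ ≤ 2r + η` when `‖a_b‖ ≤ r ≤ 1` and `‖U₀,b − 1‖ ≤ η`. [cite: Balaban1985Variational, (15) p.280] -/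
theorem norm_expField_sub_one_le (U₀ : Matrix.specialUnitaryGroup n ℂ) (a : Matrix n n ℂ) {r η : ℝ} (hr1 : r ≤ 1) (ha : ‖a‖ ≤ r) (hU : ‖(U₀ : Matrix n n ℂ) - 1‖ ≤ η) :
    ‖exp a * (U₀ : Matrix n n ℂ) - 1‖ ≤ 2 * r + η := by
  have hr0 : 0 ≤ r := (norm_nonneg _).trans ha
  have e : exp a * (U₀ : Matrix n n ℂ) - 1 = (exp a - 1) * (U₀ : Matrix n n ℂ) + ((U₀ : Matrix n n ℂ) - 1) := by noncomm_ring
  rw [e]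
  have h1 : ‖exp a - 1‖ ≤ 2 * r := by
    refine (Literature.Analysis.Calculus.ExpDifferential.norm_exp_sub_one_le_exp_norm_sub_one a).trans ?_
    have := (le_abs_self (Real.exp r - 1)).trans (Real.abs_exp_sub_one_le (x := r) (by rw [abs_of_nonneg hr0]; exact hr1))
    rw [abs_of_nonneg hr0] at this
    have hmono : Real.exp ‖a‖ ≤ Real.exp r := Real.exp_le_exp.mpr ha
    linarith
  calc _ ≤ ‖(exp a - 1) * (U₀ : Matrix n n ℂ)‖ + ‖(U₀ : Matrix n n ℂ) - 1‖ := norm_add_le _ _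
    _ ≤ 2 * r + η := by rw [CStarRing.norm_mul_mem_unitary _ U₀.2.1]; exact add_le_add h1 hU

/-- **THE TWO PERTURBED FIELDS ARE `2Δ`-CLOSE**: `‖e^{a′_b}U₀,b − e^{a_b}U₀,b‖ ≤ 2‖a′_b − a_b‖` when `‖a_b‖, ‖a′_b‖ ≤ r ≤ 1/2`. [cite: Balaban1985Variational, (15) p.280] -/
theorem norm_expField_sub_expField_le (U₀ : Matrix.specialUnitaryGroup n ℂ) (a a' : Matrix n n ℂ) {r : ℝ} (hr : r ≤ 1 / 2) (ha : ‖a‖ ≤ r) (ha' : ‖a'‖ ≤ r) :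
    ‖exp a' * (U₀ : Matrix n n ℂ) - exp a * (U₀ : Matrix n n ℂ)‖ ≤ 2 * ‖a' - a‖ := by
  have hr0 : 0 ≤ r := (norm_nonneg _).trans ha
  rw [← sub_mul, CStarRing.norm_mul_mem_unitary _ U₀.2.1]
  refine (Literature.Analysis.Complex.norm_exp_sub_exp_le a' a).trans ?_
  have hmax : max ‖a'‖ ‖a‖ ≤ r := max_le ha' ha
  have hexp : Real.exp (max ‖a'‖ ‖a‖) ≤ 2 := by
    refine (Real.exp_le_exp.mpr hmax).trans ?_
    have := (le_abs_self (Real.exp r - 1)).trans (Real.abs_exp_sub_one_le (x := r) (by rw [abs_of_nonneg hr0]; exact (by linarith)))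
    rw [abs_of_nonneg hr0] at this
    linarith
  calc ‖a' - a‖ * Real.exp (max ‖a'‖ ‖a‖) ≤ ‖a' - a‖ * 2 := mul_le_mul_of_nonneg_left hexp (norm_nonneg _)
    _ = 2 * ‖a' - a‖ := by ring

/-- **THE NON-LINEAR REST OF THE TWO-FIELD DIFFERENCE**: `e^{a′}U₀ − e^{a}U₀ = (a′ − a) + Rest`, `‖Rest‖ ≤ (2r + η)·‖a′ − a‖` (`‖a‖, ‖a′‖ ≤ r ≤ 1/2`, `‖U₀ − 1‖ ≤ η`):
`Rest = (e^{a′} − e^{a} − (a′−a))U₀ + (a′−a)(U₀ − 1)`. [cite: Balaban1985Variational, (15) p.280] -/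
theorem norm_expField_rest_le (U₀ : Matrix.specialUnitaryGroup n ℂ) (a a' : Matrix n n ℂ) {r η : ℝ} (hr : r ≤ 1 / 2) (ha : ‖a‖ ≤ r) (ha' : ‖a'‖ ≤ r)
    (hU : ‖(U₀ : Matrix n n ℂ) - 1‖ ≤ η) :
    ‖exp a' * (U₀ : Matrix n n ℂ) - exp a * (U₀ : Matrix n n ℂ) - (a' - a)‖ ≤ (2 * r + η) * ‖a' - a‖ := by
  have hr0 : 0 ≤ r := (norm_nonneg _).trans ha
  have e : exp a' * (U₀ : Matrix n n ℂ) - exp a * (U₀ : Matrix n n ℂ) - (a' - a) =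
      (exp a' - exp a - (a' - a)) * (U₀ : Matrix n n ℂ) + (a' - a) * ((U₀ : Matrix n n ℂ) - 1) := by noncomm_ring
  rw [e]
  have hmax : max ‖a'‖ ‖a‖ ≤ r := max_le ha' ha
  have h1 : ‖exp a' - exp a - (a' - a)‖ ≤ ‖a' - a‖ * (2 * r) := by
    refine (norm_exp_sub_exp_sub_sub_le a' a).trans (mul_le_mul_of_nonneg_left ?_ (norm_nonneg _))
    have := (le_abs_self (Real.exp r - 1)).trans (Real.abs_exp_sub_one_le (x := r) (by rw [abs_of_nonneg hr0]; exact (by linarith)))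
    rw [abs_of_nonneg hr0] at this
    have hmono := Real.exp_le_exp.mpr hmax
    linarith
  calc _ ≤ ‖(exp a' - exp a - (a' - a)) * (U₀ : Matrix n n ℂ)‖ + ‖(a' - a) * ((U₀ : Matrix n n ℂ) - 1)‖ := norm_add_le _ _
    _ ≤ ‖a' - a‖ * (2 * r) + ‖a' - a‖ * η := by
        rw [CStarRing.norm_mul_mem_unitary _ U₀.2.1]
        exact add_le_add h1 ((norm_mul_le _ _).trans (mul_le_mul_of_nonneg_left hU (norm_nonneg _)))
    _ = (2 * r + η) * ‖a' - a‖ := by ring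

omit [Nonempty n] in
/-- From `‖W₀V* − 1‖ ≤ η₀` and `‖W₀ − 1‖ ≤ w`: `‖V − 1‖ ≤ w + η₀` (`V* − 1 = W₀*(W₀V* − 1) + (W₀* − 1)`). [cite: Balaban1985Averaging, (19)–(20) p.21] -/
theorem norm_datum_sub_one_le (W₀ V : Matrix.specialUnitaryGroup n ℂ) {η₀ w : ℝ} (h0 : ‖(W₀ : Matrix n n ℂ) * star (V : Matrix n n ℂ) - 1‖ ≤ η₀) (hw : ‖(W₀ : Matrix n n ℂ) - 1‖ ≤ w) :
    ‖(V : Matrix n n ℂ) - 1‖ ≤ w + η₀ := by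
  have e : star (V : Matrix n n ℂ) - 1 = star (W₀ : Matrix n n ℂ) * ((W₀ : Matrix n n ℂ) * star (V : Matrix n n ℂ) - 1) + (star (W₀ : Matrix n n ℂ) - 1) := by
    calc star (V : Matrix n n ℂ) - 1 = (star (W₀ : Matrix n n ℂ) * (W₀ : Matrix n n ℂ)) * star (V : Matrix n n ℂ) - 1 := by rw [coe_star_mul_self, one_mul]
      _ = _ := by noncomm_ring
  have hstar : ‖(V : Matrix n n ℂ) - 1‖ = ‖star (V : Matrix n n ℂ) - 1‖ := by
    rw [← star_one (R := Matrix n n ℂ), ← star_sub, norm_star, star_one]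
  have hstarW : ‖star (W₀ : Matrix n n ℂ) - 1‖ = ‖(W₀ : Matrix n n ℂ) - 1‖ := by
    rw [← star_one (R := Matrix n n ℂ), ← star_sub, norm_star, star_one]
  rw [hstar, e]
  calc _ ≤ ‖star (W₀ : Matrix n n ℂ) * ((W₀ : Matrix n n ℂ) * star (V : Matrix n n ℂ) - 1)‖ + ‖star (W₀ : Matrix n n ℂ) - 1‖ := norm_add_le _ _
    _ ≤ η₀ + w := by
        rw [CStarRing.norm_mem_unitary_mul _ (Unitary.star_mem W₀.2.1), hstarW]; exact add_le_add h0 hw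
    _ = w + η₀ := add_comm _ _

omit [Nonempty n] in
/-- `‖e^{a}U₀ − U₀‖ ≤ 2‖a‖` for `‖a‖ ≤ 1`. [cite: Balaban1985Variational, (15) p.280] -/
theorem norm_expField_sub_field_le (U₀ : Matrix.specialUnitaryGroup n ℂ) (a : Matrix n n ℂ) {r : ℝ} (hr1 : r ≤ 1) (ha : ‖a‖ ≤ r) :
    ‖exp a * (U₀ : Matrix n n ℂ) - (U₀ : Matrix n n ℂ)‖ ≤ 2 * r := by
  have hr0 : 0 ≤ r := (norm_nonneg _).trans ha
  have e : exp a * (U₀ : Matrix n n ℂ) - (U₀ : Matrix n n ℂ) = (exp a - 1) * (U₀ : Matrix n n ℂ) := by noncomm_ring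
  rw [e, CStarRing.norm_mul_mem_unitary _ U₀.2.1]
  refine (Literature.Analysis.Calculus.ExpDifferential.norm_exp_sub_one_le_exp_norm_sub_one a).trans ?_
  have := (le_abs_self (Real.exp r - 1)).trans (Real.abs_exp_sub_one_le (x := r) (by rw [abs_of_nonneg hr0]; exact hr1))
  rw [abs_of_nonneg hr0] at this
  have hmono : Real.exp ‖a‖ ≤ Real.exp r := Real.exp_le_exp.mpr ha
  linarith

/-! ## §2 Hypothesis (i) of the Newton shell for the defect map, flat frame -/

set_option maxHeartbeats 800000 in
/-- **★★ THE (i)-ROW OF THE MODEL NEWTON LIFT.**  `d + 2 ≤ L`, `k` any; `U₀` a finest `SU(n)` field with `‖U₀,b − 1‖ ≤ η`; `V` a level-`k` field with defect `‖Ū₀^{(k)}(c)V(c)* − 1‖ ≤ η₀`;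
perturbations `a, a′` with `‖a_b‖, ‖a′_b‖ ≤ r ≤ 1/2`, `‖a′_b − a_b‖ ≤ Δ ≤ 2r`, and the perturbed fields `U_a = e^{a}U₀`, `U_{a′} = e^{a′}U₀`; smallness (`m(x) = 2|n|²(d+1)L^k x`):
`5200L(d+2)²(m(4r) + m(2r+η)) ≤ 1`, `4ℓ(m(4r) + m(2r+η)) < δ_N`, `ρ_D := 2m(2r) + η₀ ≤ 1/2`.  Then at every coarse bond `c`:
`‖log(Ū_{a′}^{(k)}(c)V(c)*) − log(Ū_a^{(k)}(c)V(c)*) − (Q^{(k)}(a′ − a))(c)‖ ≤ (d+1)L^k·[16|n|²ρ_D + 20800|n|²L(d+2)²(m(4r) + m(2r+η)) + (2r + η) + (2m(η) + η₀)]·Δ` —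
hypothesis (i) of `NewtonShell.exists_zero_in_range_of_approxRightInverse` for `Φ = log(Ū^{(k)}V*)`, `T = avgCLM`, with a Lipschitz constant `(d+1)L^k × (k-free small bracket)`.
[cite: Balaban1985Averaging, Prop. 4 (134)–(135) p.38, Prop. 5 (156)–(157) p.42, (20)–(23) p.21] -/
theorem norm_mlogDefect_sub_sub_linAvgIterM_le (hL : P.d + 2 ≤ P.L) (k : ℕ)
    (U₀ Ua Ua' : GaugeField P 0 (Matrix.specialUnitaryGroup n ℂ)) (V : GaugeField P k (Matrix.specialUnitaryGroup n ℂ))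
    (a a' : PBond P 0 → Matrix n n ℂ)
    (hUa : ∀ b, ((Ua b : Matrix.specialUnitaryGroup n ℂ) : Matrix n n ℂ) = exp (a b) * (U₀ b : Matrix n n ℂ))
    (hUa' : ∀ b, ((Ua' b : Matrix.specialUnitaryGroup n ℂ) : Matrix n n ℂ) = exp (a' b) * (U₀ b : Matrix n n ℂ))
    {r η η₀ Δ : ℝ} (hr : r ≤ 1 / 2) (hη : 0 ≤ η) (hη₀ : 0 ≤ η₀) (hΔr : Δ ≤ 2 * r)
    (ha : ∀ b, ‖a b‖ ≤ r) (ha' : ∀ b, ‖a' b‖ ≤ r) (hΔ : ∀ b, ‖a' b - a b‖ ≤ Δ)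
    (hU₀ : ∀ b, ‖((U₀ b : Matrix.specialUnitaryGroup n ℂ) : Matrix n n ℂ) - 1‖ ≤ η)
    (hV : ∀ c : PBond P k, ‖((Averaging.iter (fun i => blockAvg (P := P) (j := i) (expMeanLogSU (n := n))) k U₀ c : Matrix.specialUnitaryGroup n ℂ) : Matrix n n ℂ) *
        star ((V c : Matrix.specialUnitaryGroup n ℂ) : Matrix n n ℂ) - 1‖ ≤ η₀)
    (h5200 : 5200 * (P.L : ℝ) * ((P.d : ℝ) + 2) ^ 2 *
      (2 * (Fintype.card n : ℝ) ^ 2 * (((P.d : ℝ) + 1) * (P.L : ℝ) ^ k * (4 * r)) + 2 * (Fintype.card n : ℝ) ^ 2 * (((P.d : ℝ) + 1) * (P.L : ℝ) ^ k * (2 * r + η))) ≤ 1)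
    (hN : 4 * (((P.d + 2) * P.L : ℕ) : ℝ) *
      (2 * (Fintype.card n : ℝ) ^ 2 * (((P.d : ℝ) + 1) * (P.L : ℝ) ^ k * (4 * r)) + 2 * (Fintype.card n : ℝ) ^ 2 * (((P.d : ℝ) + 1) * (P.L : ℝ) ^ k * (2 * r + η))) < deltaSU n)
    (hρD : 2 * (2 * (Fintype.card n : ℝ) ^ 2 * (((P.d : ℝ) + 1) * (P.L : ℝ) ^ k * (2 * r))) + η₀ ≤ 1 / 2) (c : PBond P k) :
    ‖mlog (((Averaging.iter (fun i => blockAvg (P := P) (j := i) (expMeanLogSU (n := n))) k Ua' c : Matrix.specialUnitaryGroup n ℂ) : Matrix n n ℂ) *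
          star ((V c : Matrix.specialUnitaryGroup n ℂ) : Matrix n n ℂ)) -
        mlog (((Averaging.iter (fun i => blockAvg (P := P) (j := i) (expMeanLogSU (n := n))) k Ua c : Matrix.specialUnitaryGroup n ℂ) : Matrix n n ℂ) *
          star ((V c : Matrix.specialUnitaryGroup n ℂ) : Matrix n n ℂ)) -
        linAvgIterM k (fun b => a' b - a b) c‖ ≤
      (((P.d : ℝ) + 1) * (P.L : ℝ) ^ k) *
        (16 * (Fintype.card n : ℝ) ^ 2 * (2 * (2 * (Fintype.card n : ℝ) ^ 2 * (((P.d : ℝ) + 1) * (P.L : ℝ) ^ k * (2 * r))) + η₀) +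
          20800 * (Fintype.card n : ℝ) ^ 2 * (P.L : ℝ) * ((P.d : ℝ) + 2) ^ 2 *
            (2 * (Fintype.card n : ℝ) ^ 2 * (((P.d : ℝ) + 1) * (P.L : ℝ) ^ k * (4 * r)) + 2 * (Fintype.card n : ℝ) ^ 2 * (((P.d : ℝ) + 1) * (P.L : ℝ) ^ k * (2 * r + η))) +
          (2 * r + η) + (2 * (2 * (Fintype.card n : ℝ) ^ 2 * (((P.d : ℝ) + 1) * (P.L : ℝ) ^ k * η)) + η₀)) * Δ := by
  -- letters
  let m : ℝ → ℝ := fun x => 2 * (Fintype.card n : ℝ) ^ 2 * (((P.d : ℝ) + 1) * (P.L : ℝ) ^ k * x)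
  have hm_def : ∀ x, m x = 2 * (Fintype.card n : ℝ) ^ 2 * (((P.d : ℝ) + 1) * (P.L : ℝ) ^ k * x) := fun x => rfl
  set A : ℝ := ((P.d : ℝ) + 1) * (P.L : ℝ) ^ k with hA
  have hA0 : 0 ≤ A := by positivity
  have hcard : (0 : ℝ) ≤ 2 * (Fintype.card n : ℝ) ^ 2 := by positivity
  have hm_mono : ∀ {x y : ℝ}, x ≤ y → m x ≤ m y := fun hxy => by
    rw [hm_def, hm_def]; exact mul_le_mul_of_nonneg_left (mul_le_mul_of_nonneg_left hxy hA0) hcard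
  have hm0 : ∀ {x : ℝ}, 0 ≤ x → 0 ≤ m x := fun hx => by rw [hm_def]; positivity
  have hm_lin : ∀ x, m x = (2 * (Fintype.card n : ℝ) ^ 2 * A) * x := fun x => by rw [hm_def, hA]; ring
  have hr0 : 0 ≤ r := (norm_nonneg _).trans (ha ⟨fun _ => 0, c.dir⟩)
  have hr1 : r ≤ 1 := hr.trans (by norm_num)
  have hΔ0 : 0 ≤ Δ := (norm_nonneg _).trans (hΔ ⟨fun _ => 0, c.dir⟩)
  have hC5200 : 0 ≤ 5200 * (P.L : ℝ) * ((P.d : ℝ) + 2) ^ 2 := by positivity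
  have hℓ0 : 0 ≤ 4 * (((P.d + 2) * P.L : ℕ) : ℝ) := by positivity
  -- the averaging family and the `Q`-family
  set av : (i : ℕ) → Averaging P i (Matrix.specialUnitaryGroup n ℂ) := fun i => blockAvg (P := P) (j := i) (expMeanLogSU (n := n)) with hav
  have hQ0 : ∀ Y : PBond P 0 → Matrix n n ℂ, linAvgIterM 0 Y = Y := fun Y => linAvgIterM_zero Y
  have hQs : ∀ (i : ℕ) (Y : PBond P 0 → Matrix n n ℂ) (c : PBond P (i + 1)), linAvgIterM (i + 1) Y c = linAvg (linAvgIterM i Y) c :=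
    fun i Y c => linAvgIterM_succ i Y c
  -- field sizes
  have hUa_one : ∀ b, ‖((Ua b : Matrix.specialUnitaryGroup n ℂ) : Matrix n n ℂ) - 1‖ ≤ 2 * r + η := fun b => by
    rw [hUa b]; exact norm_expField_sub_one_le (U₀ b) (a b) hr1 (ha b) (hU₀ b)
  have hUa_U₀ : ∀ b, ‖((Ua b : Matrix.specialUnitaryGroup n ℂ) : Matrix n n ℂ) - ((U₀ b : Matrix.specialUnitaryGroup n ℂ) : Matrix n n ℂ)‖ ≤ 2 * r := fun b => by
    rw [hUa b]; exact norm_expField_sub_field_le (U₀ b) (a b) hr1 (ha b)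
  have hUa'_U₀ : ∀ b, ‖((Ua' b : Matrix.specialUnitaryGroup n ℂ) : Matrix n n ℂ) - ((U₀ b : Matrix.specialUnitaryGroup n ℂ) : Matrix n n ℂ)‖ ≤ 2 * r := fun b => by
    rw [hUa' b]; exact norm_expField_sub_field_le (U₀ b) (a' b) hr1 (ha' b)
  have hUU : ∀ b, ‖((Ua' b : Matrix.specialUnitaryGroup n ℂ) : Matrix n n ℂ) - ((Ua b : Matrix.specialUnitaryGroup n ℂ) : Matrix n n ℂ)‖ ≤ 2 * Δ := fun b => by
    rw [hUa b, hUa' b]; exact (norm_expField_sub_expField_le (U₀ b) (a b) (a' b) hr (ha b) (ha' b)).trans (by linarith [hΔ b])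
  have hRest : ∀ b, ‖((Ua' b : Matrix.specialUnitaryGroup n ℂ) : Matrix n n ℂ) - ((Ua b : Matrix.specialUnitaryGroup n ℂ) : Matrix n n ℂ) - (a' b - a b)‖ ≤ (2 * r + η) * Δ :=
    fun b => by
      rw [hUa b, hUa' b]
      refine (norm_expField_rest_le (U₀ b) (a b) (a' b) hr (ha b) (ha' b) (hU₀ b)).trans ?_
      exact mul_le_mul_of_nonneg_left (hΔ b) (by positivity)
  -- smallness in the shapes of R1∕R3
  have h2Δ : m (2 * Δ) ≤ m (4 * r) := hm_mono (by linarith)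
  have h2r : m (2 * r) ≤ m (4 * r) := hm_mono (by linarith)
  have hηm : m η ≤ m (2 * r + η) := hm_mono (by linarith)
  have hsum_nn : 0 ≤ m (4 * r) + m (2 * r + η) := add_nonneg (hm0 (by positivity)) (hm0 (by positivity))
  -- (1) `‖W₀ − 1‖ ≤ 2m(η)` (R1)
  have hR1 := EMLIterUniform.norm_iter_sub_one_sub_iterLin_le_uniform linAvgIterM hQ0 hQs hL U₀ hη hU₀ k
    (by
      have : 324 * (P.L : ℝ) * ((P.d : ℝ) + 2) ^ 2 * m η ≤ 5200 * (P.L : ℝ) * ((P.d : ℝ) + 2) ^ 2 * (m (4 * r) + m (2 * r + η)) := by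
        have h1 : (324 : ℝ) * (P.L : ℝ) * ((P.d : ℝ) + 2) ^ 2 ≤ 5200 * (P.L : ℝ) * ((P.d : ℝ) + 2) ^ 2 := by gcongr; norm_num
        have h2 : m η ≤ m (4 * r) + m (2 * r + η) := hηm.trans (le_add_of_nonneg_left (hm0 (by positivity)))
        exact mul_le_mul h1 h2 (hm0 hη) hC5200
      exact this.trans h5200)
    (by
      have : 4 * (((P.d + 2) * P.L : ℕ) : ℝ) * m η ≤ 4 * (((P.d + 2) * P.L : ℕ) : ℝ) * (m (4 * r) + m (2 * r + η)) :=
        mul_le_mul_of_nonneg_left (hηm.trans (le_add_of_nonneg_left (hm0 (by positivity)))) hℓ0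
      exact lt_of_le_of_lt this hN)
  obtain ⟨hW₀, -⟩ := hR1 k le_rfl c
  -- (2) the datum is near `1`
  have hv := norm_datum_sub_one_le _ (V c) (hV c) hW₀
  -- (3) `‖W − W₀‖, ‖W′ − W₀‖ ≤ 2m(2r)` (R3 against the start)
  have hR3_0 : ∀ (Ub : GaugeField P 0 (Matrix.specialUnitaryGroup n ℂ)),
      (∀ b, ‖((Ub b : Matrix.specialUnitaryGroup n ℂ) : Matrix n n ℂ) - ((U₀ b : Matrix.specialUnitaryGroup n ℂ) : Matrix n n ℂ)‖ ≤ 2 * r) →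
      ‖((Averaging.iter av k Ub c : Matrix.specialUnitaryGroup n ℂ) : Matrix n n ℂ) - ((Averaging.iter av k U₀ c : Matrix.specialUnitaryGroup n ℂ) : Matrix n n ℂ)‖ ≤ 2 * m (2 * r) := by
    intro Ub hUb
    have h := norm_iter_sub_iter_sub_iterLin_le_uniform linAvgIterM hQ0 hQs hL Ub U₀ hη (by positivity) hU₀ hUb k
      (by
        have : 324 * (P.L : ℝ) * ((P.d : ℝ) + 2) ^ 2 * m η ≤ 5200 * (P.L : ℝ) * ((P.d : ℝ) + 2) ^ 2 * (m (4 * r) + m (2 * r + η)) := by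
          have h1 : (324 : ℝ) * (P.L : ℝ) * ((P.d : ℝ) + 2) ^ 2 ≤ 5200 * (P.L : ℝ) * ((P.d : ℝ) + 2) ^ 2 := by gcongr; norm_num
          exact mul_le_mul h1 (hηm.trans (le_add_of_nonneg_left (hm0 (by positivity)))) (hm0 hη) hC5200
        exact this.trans h5200)
      (by
        have : 5200 * (P.L : ℝ) * ((P.d : ℝ) + 2) ^ 2 * (m (2 * r) + m η) ≤ 5200 * (P.L : ℝ) * ((P.d : ℝ) + 2) ^ 2 * (m (4 * r) + m (2 * r + η)) :=
          mul_le_mul_of_nonneg_left (add_le_add h2r hηm) hC5200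
        exact this.trans h5200)
      (by
        have : 4 * (((P.d + 2) * P.L : ℕ) : ℝ) * (m (2 * r) + m η) ≤ 4 * (((P.d + 2) * P.L : ℕ) : ℝ) * (m (4 * r) + m (2 * r + η)) :=
          mul_le_mul_of_nonneg_left (add_le_add h2r hηm) hℓ0
        exact lt_of_le_of_lt this hN)
    exact (h k le_rfl c).1
  have hW_W₀ := hR3_0 Ua hUa_U₀
  have hW'_W₀ := hR3_0 Ua' hUa'_U₀
  -- names
  set W₀ := ((Averaging.iter av k U₀ c : Matrix.specialUnitaryGroup n ℂ) : Matrix n n ℂ) with hW₀def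
  set W := ((Averaging.iter av k Ua c : Matrix.specialUnitaryGroup n ℂ) : Matrix n n ℂ) with hWdef
  set W' := ((Averaging.iter av k Ua' c : Matrix.specialUnitaryGroup n ℂ) : Matrix n n ℂ) with hW'def
  set sV := star ((V c : Matrix.specialUnitaryGroup n ℂ) : Matrix n n ℂ) with hsV
  -- (4) both defects are `ρ_D`-close to `1`
  have hdef : ∀ (X : Matrix n n ℂ), ‖X - W₀‖ ≤ 2 * m (2 * r) → ‖X * sV - 1‖ ≤ 2 * m (2 * r) + η₀ := by
    intro X hX
    have e : X * sV - 1 = (X - W₀) * sV + (W₀ * sV - 1) := by noncomm_ring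
    rw [e]
    calc _ ≤ ‖(X - W₀) * sV‖ + ‖W₀ * sV - 1‖ := norm_add_le _ _
      _ ≤ 2 * m (2 * r) + η₀ := by rw [hsV, CStarRing.norm_mul_mem_unitary _ (Unitary.star_mem (V c).2.1)]; exact add_le_add hX (hV c)
  have hD := hdef W hW_W₀
  have hD' := hdef W' hW'_W₀
  have hρD1 : 2 * m (2 * r) + η₀ < 1 := lt_of_le_of_lt hρD (by norm_num)
  -- (5) R3 for the pair `(U_{a′}, U_a)`
  have hR3 := norm_iter_sub_iter_sub_iterLin_le_uniform linAvgIterM hQ0 hQs hL Ua' Ua (by positivity) (by positivity) hUa_one hUU k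
    (by
      have : 324 * (P.L : ℝ) * ((P.d : ℝ) + 2) ^ 2 * m (2 * r + η) ≤ 5200 * (P.L : ℝ) * ((P.d : ℝ) + 2) ^ 2 * (m (4 * r) + m (2 * r + η)) := by
        have h1 : (324 : ℝ) * (P.L : ℝ) * ((P.d : ℝ) + 2) ^ 2 ≤ 5200 * (P.L : ℝ) * ((P.d : ℝ) + 2) ^ 2 := by gcongr; norm_num
        exact mul_le_mul h1 (le_add_of_nonneg_left (hm0 (by positivity))) (hm0 (by positivity)) hC5200
      exact this.trans h5200)
    (by
      have : 5200 * (P.L : ℝ) * ((P.d : ℝ) + 2) ^ 2 * (m (2 * Δ) + m (2 * r + η)) ≤ 5200 * (P.L : ℝ) * ((P.d : ℝ) + 2) ^ 2 * (m (4 * r) + m (2 * r + η)) :=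
        mul_le_mul_of_nonneg_left (add_le_add h2Δ le_rfl) hC5200
      exact this.trans h5200)
    (by
      have : 4 * (((P.d + 2) * P.L : ℕ) : ℝ) * (m (2 * Δ) + m (2 * r + η)) ≤ 4 * (((P.d + 2) * P.L : ℕ) : ℝ) * (m (4 * r) + m (2 * r + η)) :=
        mul_le_mul_of_nonneg_left (add_le_add h2Δ le_rfl) hℓ0
      exact lt_of_le_of_lt this hN)
  obtain ⟨hWW, hWWQ⟩ := hR3 k le_rfl c
  -- the `Q`-terms
  set Z : PBond P 0 → Matrix n n ℂ := fun b => ((Ua' b : Matrix.specialUnitaryGroup n ℂ) : Matrix n n ℂ) - ((Ua b : Matrix.specialUnitaryGroup n ℂ) : Matrix n n ℂ) with hZ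
  set Rest : PBond P 0 → Matrix n n ℂ := fun b => Z b - (a' b - a b) with hRestdef
  set X := linAvgIterM k (fun b => a' b - a b) c with hX
  have hlin : linAvgIterM k Z c = X + linAvgIterM k Rest c := by
    have hZsplit : Z = (fun b => a' b - a b) + Rest := by funext b; simp [hRestdef]
    rw [hZsplit, hX, ← avgCLM_apply k, ← avgCLM_apply k, ← avgCLM_apply k, map_add]
    rfl
  have hXn : ‖X‖ ≤ A * Δ := by rw [hX, hA]; exact norm_linAvgIterM_le k _ hΔ c
  have hLRest : ‖linAvgIterM k Rest c‖ ≤ A * ((2 * r + η) * Δ) := by rw [hA]; exact norm_linAvgIterM_le k _ (fun b => hRest b) c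
  -- (7) the two-field logarithm
  have hlog := norm_mlog_defect_sub_sub_le W' W (V c) hρD1 hD' hD
  have hfrac : (2 * m (2 * r) + η₀) / (1 - (2 * m (2 * r) + η₀)) ≤ 2 * (2 * m (2 * r) + η₀) := by
    rw [div_le_iff₀ (by linarith)]
    have h0 : 0 ≤ 2 * m (2 * r) + η₀ := add_nonneg (by have := hm0 (show (0:ℝ) ≤ 2 * r by positivity); linarith) hη₀
    nlinarith
  -- (8) the datum factor
  have hXV : ‖X * sV - X‖ ≤ (A * Δ) * (2 * m η + η₀) := by
    have e : X * sV - X = X * (sV - 1) := by noncomm_ring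
    rw [e]
    refine (norm_mul_le _ _).trans (mul_le_mul hXn ?_ (norm_nonneg _) (by positivity))
    have hs : star ((V c : Matrix.specialUnitaryGroup n ℂ) : Matrix n n ℂ) - 1 = star (((V c : Matrix.specialUnitaryGroup n ℂ) : Matrix n n ℂ) - 1) := by
      rw [star_sub, star_one]
    rw [hsV, hs, norm_star]
    exact hv
  -- (9) assembly
  have e : mlog (W' * sV) - mlog (W * sV) - X =
      (mlog (W' * sV) - mlog (W * sV) - (W' - W) * sV) + ((W' - W) - linAvgIterM k Z c) * sV + linAvgIterM k Rest c * sV + (X * sV - X) := by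
    rw [hlin]; noncomm_ring
  rw [e]
  have hsVn : ∀ Y : Matrix n n ℂ, ‖Y * sV‖ = ‖Y‖ := fun Y => by rw [hsV, CStarRing.norm_mul_mem_unitary _ (Unitary.star_mem (V c).2.1)]
  have t1 : ‖mlog (W' * sV) - mlog (W * sV) - (W' - W) * sV‖ ≤ 2 * (2 * m (2 * r) + η₀) * (2 * m (2 * Δ)) :=
    hlog.trans (mul_le_mul hfrac hWW (norm_nonneg _) (by positivity))
  have t2 : ‖((W' - W) - linAvgIterM k Z c) * sV‖ ≤ 5200 * (P.L : ℝ) * ((P.d : ℝ) + 2) ^ 2 * (m (2 * Δ) * (m (2 * Δ) + m (2 * r + η))) := by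
    rw [hsVn]; exact hWWQ
  have t3 : ‖linAvgIterM k Rest c * sV‖ ≤ A * ((2 * r + η) * Δ) := by rw [hsVn]; exact hLRest
  have hm2Δ : m (2 * Δ) = (2 * (Fintype.card n : ℝ) ^ 2 * A) * (2 * Δ) := hm_lin _
  calc _ ≤ ‖mlog (W' * sV) - mlog (W * sV) - (W' - W) * sV‖ + ‖((W' - W) - linAvgIterM k Z c) * sV‖ + ‖linAvgIterM k Rest c * sV‖ + ‖X * sV - X‖ := by
        refine (norm_add_le _ _).trans (add_le_add ((norm_add_le _ _).trans (add_le_add (norm_add_le _ _) le_rfl)) le_rfl)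
    _ ≤ 2 * (2 * m (2 * r) + η₀) * (2 * m (2 * Δ)) + 5200 * (P.L : ℝ) * ((P.d : ℝ) + 2) ^ 2 * (m (2 * Δ) * (m (2 * Δ) + m (2 * r + η))) +
          A * ((2 * r + η) * Δ) + (A * Δ) * (2 * m η + η₀) := add_le_add (add_le_add (add_le_add t1 t2) t3) hXV
    _ ≤ A * (16 * (Fintype.card n : ℝ) ^ 2 * (2 * m (2 * r) + η₀) + 20800 * (Fintype.card n : ℝ) ^ 2 * (P.L : ℝ) * ((P.d : ℝ) + 2) ^ 2 * (m (4 * r) + m (2 * r + η)) +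
          (2 * r + η) + (2 * m η + η₀)) * Δ := by
        rw [hm2Δ]
        have hρ0 : 0 ≤ 2 * m (2 * r) + η₀ := add_nonneg (by have := hm0 (show (0:ℝ) ≤ 2 * r by positivity); linarith) hη₀
        have hq : (2 * (Fintype.card n : ℝ) ^ 2 * A) * (2 * Δ) + m (2 * r + η) ≤ m (4 * r) + m (2 * r + η) := by rw [← hm2Δ]; exact add_le_add h2Δ le_rfl
        have hineq : 5200 * (P.L : ℝ) * ((P.d : ℝ) + 2) ^ 2 * ((2 * (Fintype.card n : ℝ) ^ 2 * A) * (2 * Δ) * ((2 * (Fintype.card n : ℝ) ^ 2 * A) * (2 * Δ) + m (2 * r + η))) ≤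
            5200 * (P.L : ℝ) * ((P.d : ℝ) + 2) ^ 2 * ((2 * (Fintype.card n : ℝ) ^ 2 * A) * (2 * Δ) * (m (4 * r) + m (2 * r + η))) := by
          refine mul_le_mul_of_nonneg_left (mul_le_mul_of_nonneg_left hq (by positivity)) hC5200
        nlinarith [hineq, hρ0, hsum_nn, hA0, hΔ0, hcard, mul_nonneg hA0 hΔ0, mul_nonneg (mul_nonneg hA0 hΔ0) hcard]
    _ = _ := by rw [hm_def, hm_def, hm_def, hm_def, hA]

end Fields

end Summit.QuantumFields.YangMills.Theorems.NewtonLiftFlat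

end
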